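import Literature.MathematicalPhysics.StatisticalMechanics.EIPMinimizerExtent
import Literature.MathematicalPhysics.StatisticalMechanics.EIPSlabConverse
import Literature.MathematicalPhysics.StatisticalMechanics.EIPSlabMinimizers
import HarnessLib

/-!
# The number of levels of an `EIP^d` minimizer: Mainini–Schmidt's maximal fluctuation estimate

We prove Theorem 1.1 (i) of Mainini–Schmidt [MS20] in every dimension,
discharging the named fact `MaininiSchmidt2020_thm11_upper`
(`EdgeIsoperimetricFluctuations.lean`):

* `MaininiSchmidt2020_thm11_upper_holds : MaininiSchmidt2020_thm11_upper` — for every `d ≥ 1` there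
  is `K_d` with `min_a #(C △ (a + W_n)) ≤ K_d · n^{(d−1+2^{1−d})/d}` for every minimizer `C` of the
  edge-isoperimetric problem `EIP^d_n` in `ℤ^d`.

By `MaininiSchmidt2020_thm11_upper_of_levelBound` (`EIPMinimizerExtent.lean`: Steiner-type
symmetrization `famStack` into cubicle stacks + the elementary box count replacing [MS20] Theorem 4.9 /
Lemma 4.10) it suffices to bound the number `T` of levels of every OPTIMAL SORTED PROFILE
(`IsOptProfile n T f`: `f` non-increasing, positive on `range T`, zero after, with
`profileCost n f T = EIP^{n+1}(Σ f)`) by `N^{1/d} + K_d N^{2^{1−d}/d}`, `d = n + 1`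
(`IsOptProfile.levels_le_rpow`, `IsOptProfile.levels_le_rpow_two`).  This is [MS20] §4, which we
carry out on the level of VALUES `EIP^{n}(·)` — after symmetrization only the level SIZES matter, and
Agnarsson–Lauria's inequalities `P`, realizability and subadditivity for the cubicle costs
(`GridEdgeIsoperimetry.lean`) encode all exchange moves:

* **Flattening** ([MS20] Lemma 4.7, `IsOptProfile.flatten`): if `b = [m,ℓ]^n` is a valid pseudo-cubic
  number with `b ≤ f_0`, an optimal profile can be modified, keeping `T`, `N`, `f_0` and optimality, so
  that every level except the top one has at least `b` points (`f'_k = max (f_k, b)`).  One step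
  (`IsOptProfile.fill_step`): the first deficient level `x = f_j < b ≤ f_{j−1}` and the top level
  `y = f_{T−1}` are replaced by `b` and `x + y − b`; optimality forces `x + y > b`
  (`IsOptProfile.lt_add`: otherwise MERGING the two levels saves `≥ 2`, by strict superadditivity
  `eipValue_add_two_le`), and [AL13]'s statement `P` (`cubicleP_all`:
  `Φ(b) + Φ(x+y−b) ≤ Φ(x) + Φ(y)`) says the cost does not increase.  (The printed proof moves daisies
  and easy points one at a time; in value form the whole of Cases 1, 2A–2C is this one inequality.)
* **The competitor** ([MS20] Corollary 4.8, `flat_profile_contradiction`): for a flat profile with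
  levels `b + e_i` (`b = [m,j]^{n} = m·φ`, `φ = [m,j]^{n−1}`, excess `e_i < φ` non-increasing — the
  lateral layer `F_2`) and top level `r`, the profile `compProfile` — `m + q` levels `φ(m+p) + e_i`
  (the top `p` box levels glued as a slab of thickness `p` onto a lateral face, `q` levels taking the
  `pq` carved `(d−2)`-slices), the untouched levels (the first `p + 1` of them also carrying the excess
  layers of the removed levels), the carved level `U = φ(m − pq)` and `r` — has the same number of
  points (`competitor_sum_arith`) and, by `eipValue_box_two_layers_le` (realizability + `P` one
  dimension down) its cost is at most the flat cost (`eipValue_pc_add_layer`, an identity,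
  `competitor_cost_arith`) minus the gain `#Θ(U) − EIP(#U) ≥ 1` of the CONVERSE SLAB LEMMA
  [MS20] Lemma 3.6 (`eipValue_deficientBox_lt`, file `EIPSlabConverse`) — a contradiction when
  `p ≥ 2`, `pq` even, `pq < m`, `T ≥ m + q + 2p + 3`, `4^{c} h_m ≤ pq`.  With `p = q = 2t`,
  `t ≈ √(4^c h_m)/2 ≈ m^{2^{−n}}` (`exists_good_t`, `m ≥ 4097`): `T ≤ m + 12 m^{2^{−n}} + 14`
  (`flat_levels_le_real`).
* **Assembly** (`IsOptProfile.levels_le_rpow`): `b = [m,j]^n` the pseudo-cubic representation of `f_0`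
  (`iroot`, `plead`), so `e_i = (f_i − b)_+ < φ`; short stacks (`T − 1 ≤ m`: `(T−1)^d ≤ N`), small
  `m ≤ 4096` (`IsOptProfile.le_of_levels_le`: compare with a stack of cubes, each level costs
  `≥ 2n` by Loomis–Whitney, `two_mul_le_eipValue`), and `m ≤ N^{1/d}` otherwise.  The planar case
  `d = 2` is `2(f_0 + T) = EIP²(N) = 2⌈2√N⌉`, `N ≤ T f_0` (`IsOptProfile.planar_le`).

Supporting identities: the pseudo-box `[m+1]^j × [m]^{k+1−j}` is the lattice box `boxConfig` with
edges `hSides`, of cardinality `[m,j]^{k+1}` and perimeter `boxPerim m j (k+1)`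
(`card_boxConfig_hSides_and_perim`, `card_deficientBox_and_perim`, `boxPerim_succ_long`).

## References
* [MS20] E. Mainini, B. Schmidt, *Maximal fluctuations around the Wulff shape for edge-isoperimetric
  sets in ℤ^d: a sharp scaling law*, Comm. Math. Phys. 380 (2020) 947–971, arXiv:2003.01679 —
  Lemma 3.6, Lemma 4.7, Corollary 4.8, Theorem 1.1 (i). (bib: MaininiSchmidt2020)
* [AL13] G. Agnarsson, J. Lauria, *Extremal subsets of boxes*, J. Integer Seq. 16 (2013) 13.8.6,
  arXiv:1305.3741 — §5 (statements P, realizability), Proposition 3.2. (bib: AgnarssonLauria2013)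
* [MPSS19] E. Mainini, P. Piovano, B. Schmidt, U. Stefanelli, *N^{3/4} law in the cubic lattice*,
  J. Stat. Phys. 176 (2019) 1480–1499 — Theorem 1.2 (d = 2, 3). (bib: MaininiPiovanoSchmidtStefanelli2019)
* [LW49] L. H. Loomis, H. Whitney, *An inequality related to the isoperimetric inequality*,
  Bull. AMS 55 (1949) 961–962. (bib: LoomisWhitney1949)
-/

noncomputable section

open Finset

namespace Literature.MathematicalPhysics.StatisticalMechanics

open Literature.Probability.LatticeModels

/-! ### Pseudo-boxes as lattice boxes: cardinality `[m,j]^k` and perimeter `boxPerim m j k` -/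

section PseudoBox

/-- `(m+1)·[m,ℓ]^d = [m,ℓ+1]^{d+1}`: a pseudo `(d+1)`-cube with one more long edge is `m + 1` slices.
[cite: AgnarssonLauria2013, Definition 5.1 and Claim 5.2] -/
theorem succ_mul_pc (m ℓ d : ℕ) : (m + 1) * pc m ℓ d = pc m (ℓ + 1) (d + 1) := by
  unfold pc
  rw [show d + 1 - (ℓ + 1) = d - ℓ by omega, pow_succ]
  ring

/-- Peeling a LONG edge: `boxPerim m (j+1) (d+1) = 2·[m,j]^d + (m+1)·boxPerim m j d` (`j ≤ d`) — the
companion of `boxPerim_succ_dim` (which peels a short edge). [cite: AgnarssonLauria2013, §5 eq. (F(pc)-sliced)] -/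
theorem boxPerim_succ_long (m j : ℕ) {d : ℕ} (hj : j ≤ d) :
    boxPerim m (j + 1) (d + 1) = 2 * pc m j d + (m + 1) * boxPerim m j d := by
  unfold boxPerim
  rw [Nat.add_sub_cancel, Nat.add_sub_cancel, show d + 1 - (j + 1) = d - j by omega]
  rcases Nat.eq_zero_or_pos j with rfl | hj1
  · simp only [zero_mul, zero_add, Nat.sub_zero, one_mul]
    rcases Nat.eq_zero_or_pos d with rfl | hd
    · simp [pc]
    · obtain ⟨e, rfl⟩ : ∃ e, d = e + 1 := ⟨d - 1, by omega⟩
      rw [Nat.add_sub_cancel, ← succ_mul_pc m 0 e]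
      ring
  · obtain ⟨i, rfl⟩ : ∃ i, j = i + 1 := ⟨j - 1, by omega⟩
    obtain ⟨e, rfl⟩ : ∃ e, d = e + 1 := ⟨d - 1, by omega⟩
    rw [Nat.add_sub_cancel, Nat.add_sub_cancel, ← succ_mul_pc m i e, ← succ_mul_pc m (i + 1) e,
      show e + 1 - (i + 1) = e - i by omega]
    ring

variable {m : ℕ}

/-- **The pseudo-box `[m+1]^j × [m]^{k+1−j}` as a lattice box** (edges `hSides k m j`, `j ≤ k + 1`,
`m ≥ 1`): it has `[m,j]^{k+1}` points and edge perimeter `boxPerim m j (k+1)` — Agnarsson–Lauria's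
formula (F(pc)-exactl) is the perimeter of an actual box. [cite: AgnarssonLauria2013, §5 eq. (F(pc)-exactl) and Observation 5.12] -/
theorem card_boxConfig_hSides_and_perim (hm : 1 ≤ m) :
    ∀ k j : ℕ, j ≤ k + 1 →
      #(boxConfig (k + 1) (hSides k m j)) = pc m j (k + 1) ∧
        #(boundaryPairs (boxConfig (k + 1) (hSides k m j))) = boxPerim m j (k + 1) := by
  intro k
  induction k with
  | zero =>
    intro j hj
    have hs : hSides 0 m j = Fin.cons (m + if 0 < j then 1 else 0) Fin.elim0 := by
      funext i
      rw [Fin.fin_one_eq_zero i, Fin.cons_zero, hSides_zero]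
    rw [hs, card_boxConfig_cons, card_boxConfig_zero,
      card_boundaryPairs_boxConfig_cons (by split_ifs <;> omega) (fun i => i.elim0),
      card_boxConfig_zero, card_boundaryPairs_site_zero']
    interval_cases j <;> simp [pc, boxPerim]
  | succ k ih =>
    intro j hj
    rw [hSides_succ_eq_cons, card_boxConfig_cons,
      card_boundaryPairs_boxConfig_cons (by split_ifs <;> omega) (hSides_pos hm k (j - 1))]
    rcases Nat.eq_zero_or_pos j with rfl | hj1
    · simp only [lt_irrefl, if_false, add_zero, Nat.zero_sub]
      obtain ⟨h1, h2⟩ := ih 0 (Nat.zero_le _)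
      rw [h1, h2, mul_pc m 0 (Nat.zero_le _), boxPerim_succ_dim m 0 (d := k + 1) (Nat.zero_le _)]
      exact ⟨rfl, rfl⟩
    · rw [if_pos hj1]
      obtain ⟨h1, h2⟩ := ih (j - 1) (by omega)
      obtain ⟨i, rfl⟩ : ∃ i, j = i + 1 := ⟨j - 1, by omega⟩
      rw [Nat.add_sub_cancel] at h1 h2 ⊢
      rw [h1, h2, succ_mul_pc, boxPerim_succ_long m i (by omega)]
      exact ⟨rfl, rfl⟩

/-- Cardinality and perimeter of the deficient box `P_{ℓ,j,n,q}` in Agnarsson–Lauria's terms: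
`#P = (ℓ − q)·[ℓ,j]^{n−1}` and `#Θ_n(P) = 2[ℓ,j]^{n−1} + (ℓ − q)·boxPerim ℓ j (n−1)` (`n = k + 2`,
`j ≤ k + 1`, `q < ℓ`). [cite: MaininiSchmidt2020, Lemma 3.6; AgnarssonLauria2013, §5 eq. (F(pc)-sliced)] -/
theorem card_deficientBox_and_perim {ℓ q : ℕ} (hq : q < ℓ) (k j : ℕ) (hj : j ≤ k + 1) :
    #(deficientBox k ℓ j q) = (ℓ - q) * pc ℓ j (k + 1) ∧
      #(boundaryPairs (deficientBox k ℓ j q)) =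
        2 * pc ℓ j (k + 1) + (ℓ - q) * boxPerim ℓ j (k + 1) := by
  have hℓ : 1 ≤ ℓ := by omega
  obtain ⟨h1, h2⟩ := card_boxConfig_hSides_and_perim hℓ k j hj
  unfold deficientBox
  rw [card_boxConfig_cons, card_boundaryPairs_boxConfig_cons (by omega) (hSides_pos hℓ k j), h1, h2]
  exact ⟨rfl, rfl⟩

end PseudoBox


/-! ### Flattening optimal profiles ([MS20] Lemma 4.7 in value form, via [AL13] statement P) -/

section Flatten

variable {n : ℕ}

/-- An **optimal sorted profile** over `ℤ^n` with `T` levels: non-increasing, positive exactly on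
`[0, T)`, and of minimal cost `2 f(0) + Σ_{k<T} EIP^n(f k) = EIP^{n+1}(Σ f)` — the level sizes of a
sorted stack of nested `EIP^n` minimizers which is an `EIP^{n+1}` minimizer ([MS20] Proposition 3.2).
[cite: MaininiSchmidt2020, Proposition 3.2 and Lemma 4.7 (the levels P_j)] -/
structure IsOptProfile (n T : ℕ) (f : ℕ → ℕ) : Prop where
  antitone : Antitone f
  eq_zero : ∀ k, T ≤ k → f k = 0
  pos : ∀ k, k < T → 0 < f k
  cost : profileCost n f T = eipValue (n + 1) (∑ k ∈ range T, f k)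

/-- Splitting a sum over `range T` at two distinct indices. [folklore] -/
private theorem sum_range_split {T j : ℕ} (hj : j + 1 < T) (h : ℕ → ℕ) :
    ∑ k ∈ range T, h k = h j + h (T - 1) + ∑ k ∈ ((range T).erase j).erase (T - 1), h k := by
  have hj' : j ∈ range T := mem_range.2 (by omega)
  have hT : T - 1 ∈ (range T).erase j := mem_erase.2 ⟨by omega, mem_range.2 (by omega)⟩
  rw [← add_sum_erase _ _ hj', ← add_sum_erase _ _ hT, add_assoc]

/-- **No two levels of an optimal profile can be merged below the level above**: if `j ≥ 1` and
`j < T − 1`, then `f j + f (T−1) > f (j−1)` is impossible to violate — precisely, `f j + f (T−1) ≤ c`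
with `c ≤ f (j−1)` contradicts optimality, by the strict subadditivity `EIP^n(x+y) + 2 ≤ EIP^n(x) + EIP^n(y)`
(merging the two levels into one keeps the stack sorted and saves at least one bond).  This is the
only use of minimality in the flattening ("contradicting the minimality of `C'`", [MS20] p. 15).
[cite: MaininiSchmidt2020, Lemma 4.7 (proof, Case 2: "contradict the minimality of C'")] -/
theorem IsOptProfile.lt_add (hn : 1 ≤ n) {T : ℕ} {f : ℕ → ℕ} (hf : IsOptProfile n T f) {j : ℕ}
    (hj1 : 1 ≤ j) (hjT : j + 1 < T) (hle : f j + f (T - 1) ≤ f (j - 1)) : False := by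
  classical
  obtain ⟨D, hD⟩ := exists_isNestedMinimizerFamily (d := n) hn
  have hxpos : 0 < f j := hf.pos j (by omega)
  have hypos : 0 < f (T - 1) := hf.pos (T - 1) (by omega)
  have hfa := hf.antitone
  -- the merged profile
  set g : ℕ → ℕ := fun k => if k = j then f j + f (T - 1) else if k < T - 1 then f k else 0 with hg
  have hgj : g j = f j + f (T - 1) := by simp [hg]
  have hg0 : g 0 = f 0 := by simp only [hg]; rw [if_neg (by omega), if_pos (by omega)]
  have hgk : ∀ k ∈ (range (T - 1)).erase j, g k = f k := by
    intro k hk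
    rw [mem_erase, mem_range] at hk
    simp only [hg]; rw [if_neg hk.1, if_pos hk.2]
  have hga : Antitone g := by
    intro a c hac
    show g c ≤ g a
    simp only [hg]
    by_cases hcj : c = j
    · rw [if_pos hcj]
      by_cases haj : a = j
      · rw [if_pos haj]
      · rw [if_neg haj, if_pos (by omega : a < T - 1)]
        have := hfa (show a ≤ j - 1 by omega)
        omega
    · rw [if_neg hcj]
      by_cases hcT : c < T - 1
      · rw [if_pos hcT]
        by_cases haj : a = j
        · rw [if_pos haj]
          have := hfa (show j ≤ c by omega)
          omega
        · rw [if_neg haj, if_pos (by omega : a < T - 1)]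
          exact hfa hac
      · rw [if_neg hcT]; exact Nat.zero_le _
  have hgT : g (T - 1) = 0 := by simp only [hg]; rw [if_neg (by omega), if_neg (lt_irrefl _)]
  have hsplit : ((range T).erase j).erase (T - 1) = (range (T - 1)).erase j := by
    ext k; simp only [mem_erase, mem_range]; omega
  have hj' : j ∈ range (T - 1) := mem_range.2 (by omega)
  have hsumg : ∑ k ∈ range (T - 1), g k = ∑ k ∈ range T, f k := by
    have hrest : ∑ k ∈ (range (T - 1)).erase j, g k = ∑ k ∈ (range (T - 1)).erase j, f k :=
      sum_congr rfl hgk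
    rw [sum_range_split hjT f, ← add_sum_erase _ _ hj', hrest, hgj, hsplit]
  have hcostg : profileCost n g (T - 1) + eipValue n (f j) + eipValue n (f (T - 1)) =
      profileCost n f T + eipValue n (f j + f (T - 1)) := by
    have hrest : ∑ k ∈ (range (T - 1)).erase j, eipValue n (g k) =
        ∑ k ∈ (range (T - 1)).erase j, eipValue n (f k) :=
      sum_congr rfl fun k hk => by rw [hgk k hk]
    rw [profileCost_def, profileCost_def, sum_range_split hjT (fun k => eipValue n (f k)),
      ← add_sum_erase _ _ hj', hrest, hgj, hg0, hsplit]
    ring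
  have hstrict := eipValue_add_two_le hn hxpos hypos
  have hreal := eipValue_succ_le_profileCost hD hga hgT
  rw [hsumg, ← hf.cost] at hreal
  omega

/-- **One flattening step** ([MS20] Lemma 4.7, value form).  Let `b = [m,ℓ]^n` be a pseudo-cubic
number (`m ≥ 1`, `ℓ + 1 ≤ n`) and `f` an optimal sorted profile with `f(j−1) ≥ b > f(j)` for some
`1 ≤ j ≤ T − 2`.  Then filling level `j` up to exactly `b` with points of the top level `T − 1`
gives again an optimal sorted profile with `T` levels: by `IsOptProfile.lt_add`,
`f j + f (T−1) > b`, and by Agnarsson–Lauria's statement `P(n, b)` (`cubicleP_all`: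
`Φ(b) + Φ(x + y − b) ≤ Φ(x) + Φ(y)` for `x, y ≤ b ≤ x + y`) the cost does not increase — this single
inequality replaces the daisy/defect algorithm (Cases 1, 2, A, B, C1, C2) of the printed proof, whose
outcome is the same (the `j`-level becomes the perfect daisy, the top level is not exhausted).
[cite: MaininiSchmidt2020, Lemma 4.7 (proof: "it is possible to move a point from the a_d-level to the j-th level"); AgnarssonLauria2013, §5 (statement P(d,n))] -/
theorem IsOptProfile.fill_step (hn : 1 ≤ n) {T : ℕ} {f : ℕ → ℕ} (hf : IsOptProfile n T f)
    {m ℓ : ℕ} (hm : 1 ≤ m) (hℓ : ℓ + 1 ≤ n) {j : ℕ} (hj1 : 1 ≤ j) (hjT : j + 1 < T)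
    (hprev : pc m ℓ n ≤ f (j - 1)) (hlt : f j < pc m ℓ n) :
    IsOptProfile n T (Function.update (Function.update f j (pc m ℓ n)) (T - 1)
        (f j + f (T - 1) - pc m ℓ n)) ∧
      ∑ k ∈ range T, Function.update (Function.update f j (pc m ℓ n)) (T - 1)
          (f j + f (T - 1) - pc m ℓ n) k = ∑ k ∈ range T, f k := by
  classical
  -- [AL13] statement P, before generalising `b`
  have hxy : pc m ℓ n < f j + f (T - 1) := by
    by_contra h
    exact hf.lt_add hn hj1 hjT ((not_lt.1 h).trans hprev)
  have hP := cubicleP_all n m ℓ (f j) (f (T - 1)) hm hℓ hlt.le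
    ((hf.antitone (by omega : j ≤ T - 1)).trans hlt.le) hxy.le
  rw [← eipValue_eq_cubicleCost hn, ← eipValue_eq_cubicleCost hn, ← eipValue_eq_cubicleCost hn,
    ← eipValue_eq_cubicleCost hn] at hP
  have hbpos : 0 < pc m ℓ n := pc_pos hm _ _
  generalize hb : pc m ℓ n = b at *
  have hfa := hf.antitone
  have hyx : f (T - 1) ≤ f j := hfa (by omega)
  set f' := Function.update (Function.update f j b) (T - 1) (f j + f (T - 1) - b) with hf'
  have hf'j : f' j = b := by
    rw [hf', Function.update_of_ne (by omega), Function.update_self]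
  have hf'T : f' (T - 1) = f j + f (T - 1) - b := by rw [hf', Function.update_self]
  have hf'k : ∀ k, k ≠ j → k ≠ T - 1 → f' k = f k := fun k h1 h2 => by
    rw [hf', Function.update_of_ne h2, Function.update_of_ne h1]
  have hrest0 : ∀ k ∈ ((range T).erase j).erase (T - 1), f' k = f k := by
    intro k hk
    rw [mem_erase, mem_erase] at hk
    exact hf'k k hk.2.1 hk.1
  -- sums
  have hsum : ∑ k ∈ range T, f' k = ∑ k ∈ range T, f k := by
    have hrest : ∑ k ∈ ((range T).erase j).erase (T - 1), f' k =
        ∑ k ∈ ((range T).erase j).erase (T - 1), f k := sum_congr rfl hrest0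
    rw [sum_range_split hjT f', sum_range_split hjT f, hrest, hf'j, hf'T]
    omega
  have hcost : profileCost n f' T + (eipValue n (f j) + eipValue n (f (T - 1))) =
      profileCost n f T + (eipValue n b + eipValue n (f j + f (T - 1) - b)) := by
    have hrest : ∑ k ∈ ((range T).erase j).erase (T - 1), eipValue n (f' k) =
        ∑ k ∈ ((range T).erase j).erase (T - 1), eipValue n (f k) :=
      sum_congr rfl fun k hk => by rw [hrest0 k hk]
    rw [profileCost_def, profileCost_def, sum_range_split hjT (fun k => eipValue n (f' k)),
      sum_range_split hjT (fun k => eipValue n (f k)), hrest, hf'j, hf'T,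
      hf'k 0 (by omega) (by omega)]
    ring
  -- antitone
  have hanti : Antitone f' := by
    intro a c hac
    show f' c ≤ f' a
    rcases hac.lt_or_eq with hac | rfl
    · by_cases ha1 : a = j
      · subst ha1
        rw [hf'j]
        by_cases hc : c = T - 1
        · rw [hc, hf'T]; omega
        · rw [hf'k c (by omega) hc]
          exact (hfa hac.le).trans hlt.le
      · by_cases ha2 : a = T - 1
        · have : f' c = 0 := by
            rw [hf'k c (by omega) (by omega)]; exact hf.eq_zero c (by omega)
          rw [this]; exact Nat.zero_le _
        · rw [hf'k a ha1 ha2]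
          by_cases hc1 : c = j
          · rw [hc1, hf'j]; exact hprev.trans (hfa (by omega))
          · by_cases hc2 : c = T - 1
            · rw [hc2, hf'T]
              by_cases hjT2 : j + 2 = T
              · -- then `a < j`
                have h1 : f (j - 1) ≤ f a := hfa (by omega)
                omega
              · have h1 : f (T - 2) ≤ f a := hfa (by omega)
                have h2 : f (T - 1) ≤ f (T - 2) := hfa (by omega)
                omega
            · rw [hf'k c hc1 hc2]; exact hfa hac.le
    · exact le_rfl
  have hT0 : f' T = 0 := by rw [hf'k T (by omega) (by omega)]; exact hf.eq_zero T le_rfl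
  refine ⟨⟨hanti, ?_, ?_, ?_⟩, hsum⟩
  · intro k hk
    rw [hf'k k (by omega) (by omega)]; exact hf.eq_zero k hk
  · intro k hk
    by_cases h1 : k = j
    · rw [h1, hf'j]; exact hbpos
    · by_cases h2 : k = T - 1
      · rw [h2, hf'T]; omega
      · rw [hf'k k h1 h2]; exact hf.pos k hk
  · rw [hsum, ← hf.cost]
    refine le_antisymm ?_ ?_
    · omega
    · obtain ⟨D, hD⟩ := exists_isNestedMinimizerFamily (d := n) hn
      have h := eipValue_succ_le_profileCost hD hanti hT0
      rw [hsum, ← hf.cost] at h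
      exact h

/-- **Flattening** ([MS20] Lemma 4.7 in value form: "with a finite number of steps we reach a
configuration of the form (4.1)").  Let `b = [m,ℓ]^n` be pseudo-cubic and `f` an optimal sorted
profile with `T` levels and `f(0) ≥ b`.  Then there is an optimal sorted profile `f'` with the same
number of levels `T`, the same total, `f' k = f k` wherever `f k ≥ b` or `k = 0`, and
`f' k ≥ b` for ALL levels `k ≤ T − 2` — all levels but the top one contain the box, i.e. the
quasi-cube `B × {1,…,a_d − 1} ∪ F_1 ∪ F_2` of (4.1) at the level of cardinalities.
[cite: MaininiSchmidt2020, Lemma 4.7 (eq. (4.1))] -/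
theorem IsOptProfile.flatten (hn : 1 ≤ n) {m ℓ : ℕ} (hm : 1 ≤ m) (hℓ : ℓ + 1 ≤ n) :
    ∀ (c T : ℕ) (f : ℕ → ℕ), IsOptProfile n T f → pc m ℓ n ≤ f 0 →
      #((range (T - 1)).filter fun k => f k < pc m ℓ n) ≤ c →
      ∃ f' : ℕ → ℕ, IsOptProfile n T f' ∧ ∑ k ∈ range T, f' k = ∑ k ∈ range T, f k ∧
        f' 0 = f 0 ∧ (∀ k, k < T - 1 → f' k = max (f k) (pc m ℓ n)) := by
  classical
  intro c
  induction c with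
  | zero =>
    intro T f hf h0 hc
    refine ⟨f, hf, rfl, rfl, fun k hk => ?_⟩
    symm
    refine max_eq_left ?_
    by_contra h
    have : k ∈ (range (T - 1)).filter fun k => f k < pc m ℓ n :=
      mem_filter.2 ⟨mem_range.2 hk, not_le.1 h⟩
    rw [Nat.le_zero, card_eq_zero] at hc
    rw [hc] at this
    exact notMem_empty _ this
  | succ c ih =>
    intro T f hf h0 hc
    set b := pc m ℓ n with hb
    set S := (range (T - 1)).filter fun k => f k < b with hS
    by_cases hSe : S = ∅
    · exact ih T f hf h0 (by rw [← hS, hSe, card_empty]; exact Nat.zero_le _)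
    -- the first defective level
    obtain ⟨j, hjS, hjmin⟩ := exists_min_image S id (nonempty_iff_ne_empty.2 hSe)
    rw [hS, mem_filter, mem_range] at hjS
    have hj1 : 1 ≤ j := by
      by_contra h
      have : j = 0 := by omega
      rw [this] at hjS
      exact absurd h0 (not_le.2 hjS.2)
    have hjT : j + 1 < T := by omega
    have hprev : b ≤ f (j - 1) := by
      by_contra h
      have hmem : j - 1 ∈ S := by
        rw [hS, mem_filter, mem_range]; exact ⟨by omega, not_le.1 h⟩
      have := hjmin (j - 1) hmem
      simp only [id] at this
      omega
    obtain ⟨hf', hsum'⟩ := hf.fill_step hn hm hℓ hj1 hjT hprev hjS.2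
    set f' := Function.update (Function.update f j b) (T - 1) (f j + f (T - 1) - b) with hf'def
    have hf'j : f' j = b := by
      rw [hf'def, Function.update_of_ne (by omega), Function.update_self]
    have hf'k : ∀ k, k ≠ j → k ≠ T - 1 → f' k = f k := fun k h1 h2 => by
      rw [hf'def, Function.update_of_ne h2, Function.update_of_ne h1]
    -- the defect count drops
    have hcard : #((range (T - 1)).filter fun k => f' k < b) ≤ c := by
      have hsub : ((range (T - 1)).filter fun k => f' k < b) ⊆ S.erase j := by
        intro k hk
        rw [mem_filter, mem_range] at hk
        rw [mem_erase, hS, mem_filter, mem_range]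
        have hkj : k ≠ j := by
          rintro rfl; rw [hf'j] at hk; exact lt_irrefl _ hk.2
        refine ⟨hkj, hk.1, ?_⟩
        rw [hf'k k hkj (by omega)] at hk
        exact hk.2
      have h1 := card_le_card hsub
      have hjS' : j ∈ S := by rw [hS, mem_filter, mem_range]; exact hjS
      rw [card_erase_of_mem hjS'] at h1
      have : 1 ≤ #S := card_pos.2 ⟨j, hjS'⟩
      omega
    have h0' : b ≤ f' 0 := by rw [hf'k 0 (by omega) (by omega)]; exact h0
    obtain ⟨g, hg, hgsum, hg0, hgmax⟩ := ih T f' hf' h0' hcard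
    refine ⟨g, hg, hgsum.trans hsum', ?_, ?_⟩
    · rw [hg0, hf'k 0 (by omega) (by omega)]
    · intro k hk
      rw [hgmax k hk]
      by_cases hkj : k = j
      · rw [hkj, hf'j, max_self, max_eq_right hjS.2.le]
      · rw [hf'k k hkj (by omega)]

end Flatten


/-! ### The cut-and-paste competitor ([MS20] Corollary 4.8 in value form) -/

section Competitor

variable {k : ℕ}

/-- `EIP^{k+1}` of a pseudo-cubic face: `Φ_{k+1}([m,j]^{k+1}) = boxPerim m j (k+1)` also in the top case
`j = k + 1`. [cite: AgnarssonLauria2013, eq. (F(pc)-exactl)] -/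
theorem cubicleCost_pc_le_succ {m j : ℕ} (hm : 1 ≤ m) (hj : j ≤ k + 1) :
    cubicleCost (k + 1) (pc m j (k + 1)) = boxPerim m j (k + 1) := by
  rcases hj.lt_or_eq with h | rfl
  · exact cubicleCost_pc (by omega) hm (by omega)
  · exact cubicleCost_pc_self (by omega) m

/-- **Cost of a box level carrying up to two partial face layers** (value form of gluing `EIP^{k+1}`
minimizers of `e, e' ≤ [m,j]^{k+1}` points onto two opposite faces of the box
`[m+1]^j × [m]^{k+1−j} × [m+u]`): `EIP^{k+2}((m+u)φ + e + e') ≤ 2φ + (m+u)·Φ(φ) + Φ(e) + Φ(e')`,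
`φ = [m,j]^{k+1}` — by [AL13]'s realizability (`cubicleReal_all`), subadditivity and statement `P`
one dimension down. [cite: MaininiSchmidt2020, Corollary 4.8 (proof: the block moved to a lateral face, F_2 carried along); AgnarssonLauria2013, §5 (statements P' and P)] -/
theorem eipValue_box_two_layers_le {m j : ℕ} (hm : 1 ≤ m) (hj : j ≤ k + 1) (u : ℕ) {e e' : ℕ}
    (he : e ≤ pc m j (k + 1)) (he' : e' ≤ pc m j (k + 1)) :
    eipValue (k + 2) ((m + u) * pc m j (k + 1) + e + e') ≤
      2 * pc m j (k + 1) + (m + u) * eipValue (k + 1) (pc m j (k + 1)) +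
        eipValue (k + 1) e + eipValue (k + 1) e' := by
  set φ := pc m j (k + 1) with hφ
  rw [eipValue_eq_cubicleCost (by omega), eipValue_eq_cubicleCost (by omega),
    eipValue_eq_cubicleCost (by omega), eipValue_eq_cubicleCost (by omega)]
  have hR := cubicleReal_all (k + 2)
  have hS := cubicleSubadd_all (k + 1)
  have hk : k + 2 - 1 = k + 1 := by omega
  simp only [CubicleReal, hk] at hR
  by_cases hsum : e + e' ≤ φ
  · have h1 := hR φ (m + u) (e + e') (by omega) hsum
    have h2 := hS e e'
    rw [add_assoc]
    omega
  · -- overflow: complete one more slab and use statement `P` for the face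
    obtain ⟨m', ℓ', hm', hℓ', hpc⟩ := exists_valid_pc (D := k + 1) (by omega) hm hj
    have h1 := hR φ (m + u + 1) (e + e' - φ) (by omega) (by omega)
    have hP := cubicleP_all (k + 1) m' ℓ' e e' hm' hℓ' (by rw [hpc]; exact he)
      (by rw [hpc]; exact he') (by rw [hpc, ← hφ]; omega)
    rw [hpc, ← hφ] at hP
    have heq : (m + u) * φ + e + e' = (m + u + 1) * φ + (e + e' - φ) := by
      have h3 : (m + u + 1) * φ = (m + u) * φ + φ := by ring
      omega
    rw [heq]
    have : (m + u + 1) * cubicleCost (k + 1) φ =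
        (m + u) * cubicleCost (k + 1) φ + cubicleCost (k + 1) φ := by ring
    omega

/-- **Exact cost of a flat level** `b + e = [m,j]^{k+2} + e`, `e ≤ φ = [m,j]^{k+1}`:
`EIP^{k+2}(b + e) = 2φ + m·Φ(φ) + Φ(e)` (eq. (F(n)-rec): the pseudo-box plus a partial face layer IS
the cubicle). [cite: AgnarssonLauria2013, eq. (F(n)-rec) and (F(pc)-sliced)] -/
theorem eipValue_pc_add_layer {m j : ℕ} (hm : 1 ≤ m) (hj : j + 1 ≤ k + 2) {e : ℕ}
    (he : e ≤ pc m j (k + 1)) :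
    eipValue (k + 2) (pc m j (k + 2) + e) =
      2 * pc m j (k + 1) + m * eipValue (k + 1) (pc m j (k + 1)) + eipValue (k + 1) e := by
  have hk : k + 2 - 1 = k + 1 := rfl
  rw [eipValue_eq_cubicleCost (by omega), eipValue_eq_cubicleCost (by omega),
    eipValue_eq_cubicleCost (by omega),
    cubicleCost_pc_add (d := k + 2) (by omega) hm (by omega) he, hk,
    boxPerim_succ_dim m j (by omega), cubicleCost_pc_le_succ hm (by omega)]

/-- **The competitor profile of [MS20] Corollary 4.8 (value form)**: `A` extended levels `c + e_i`,
`B` plain levels `b + e_{A+i}` (the first `P` of them also carrying the relocated excess layers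
`e_{A+B+i}`), then the two levels `{r, U}` in decreasing order. [cite: MaininiSchmidt2020, Corollary 4.8 (proof: the configuration after moving the block and the (d−2)-dimensional faces)] -/
def compProfile (A B P b c r U : ℕ) (e : ℕ → ℕ) (i : ℕ) : ℕ :=
  if i < A then c + e i
  else if i < A + B then b + e i + (if i < A + P then e (B + i) else 0)
  else if i = A + B then max r U else if i = A + B + 1 then min r U else 0

section CompProfile

variable {A B P b c r U : ℕ} {e : ℕ → ℕ}

/-- The competitor profile vanishes from index `A + B + 2` on. [cite: MaininiSchmidt2020, Corollary 4.8] -/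
theorem compProfile_eq_zero' {i : ℕ} (hi : A + B + 2 ≤ i) : compProfile A B P b c r U e i = 0 := by
  simp only [compProfile]
  rw [if_neg (by omega), if_neg (by omega), if_neg (by omega), if_neg (by omega)]

/-- Evaluation of the competitor profile on its four blocks. [cite: MaininiSchmidt2020, Corollary 4.8] -/
theorem compProfile_of_lt {i : ℕ} (hi : i < A) : compProfile A B P b c r U e i = c + e i := by
  simp only [compProfile]; rw [if_pos hi]

/-- Evaluation on the plain block. [cite: MaininiSchmidt2020, Corollary 4.8] -/
theorem compProfile_of_mid {i : ℕ} (h1 : A ≤ i) (h2 : i < A + B) :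
    compProfile A B P b c r U e i = b + e i + (if i < A + P then e (B + i) else 0) := by
  simp only [compProfile]; rw [if_neg (by omega), if_pos h2]

/-- Evaluation at the larger of the two last levels. [cite: MaininiSchmidt2020, Corollary 4.8] -/
theorem compProfile_AB : compProfile A B P b c r U e (A + B) = max r U := by
  simp only [compProfile]; rw [if_neg (by omega), if_neg (by omega)]; simp

/-- Evaluation at the smaller of the two last levels. [cite: MaininiSchmidt2020, Corollary 4.8] -/
theorem compProfile_AB_one : compProfile A B P b c r U e (A + B + 1) = min r U := by
  simp only [compProfile]; rw [if_neg (by omega), if_neg (by omega), if_neg (by omega)]; simp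

/-- The competitor profile is non-increasing. [cite: MaininiSchmidt2020, Corollary 4.8] -/
theorem compProfile_antitone {φ' i₀ : ℕ} (he : Antitone e) (heφ : ∀ i, e i ≤ φ') (hcb : b + φ' ≤ c)
    (hi₀ : A + B ≤ i₀ + 1) (hr : r ≤ b + e i₀) (hU : U ≤ b) :
    Antitone (compProfile A B P b c r U e) := by
  have hS : ∀ x y, x ≤ y → (if y < A + P then e (B + y) else 0) ≤ (if x < A + P then e (B + x) else 0) := by
    intro x y hxy
    split_ifs with h1 h2
    · exact he (by omega)
    · omega
    · exact Nat.zero_le _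
    · exact le_rfl
  have hSφ : ∀ y, (if y < A + P then e (B + y) else 0) ≤ φ' := by
    intro y; split_ifs; exacts [heφ _, Nat.zero_le _]
  have hmax : ∀ z, z < A + B → max r U ≤ b + e z := fun z hz =>
    max_le (hr.trans (Nat.add_le_add_left (he (by omega)) _)) (hU.trans (Nat.le_add_right _ _))
  intro x y hxy
  show compProfile A B P b c r U e y ≤ compProfile A B P b c r U e x
  have hex := he hxy
  by_cases hy1 : y < A
  · rw [compProfile_of_lt hy1, compProfile_of_lt (by omega : x < A)]; omega
  by_cases hy2 : y < A + B
  · rw [compProfile_of_mid (by omega) hy2]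
    by_cases hx1 : x < A
    · rw [compProfile_of_lt hx1]
      have := hSφ y
      omega
    · rw [compProfile_of_mid (by omega) (by omega)]
      have := hS x y hxy
      omega
  -- `y ≥ A + B`
  have hyval : compProfile A B P b c r U e y ≤ max r U := by
    by_cases hy3 : y = A + B
    · rw [hy3, compProfile_AB]
    · by_cases hy4 : y = A + B + 1
      · rw [hy4, compProfile_AB_one]; exact min_le_max
      · rw [compProfile_eq_zero' (by omega)]; exact Nat.zero_le _
  by_cases hx1 : x < A
  · rw [compProfile_of_lt hx1]
    refine hyval.trans ((hmax x (by omega)).trans ?_)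
    omega
  by_cases hx2 : x < A + B
  · rw [compProfile_of_mid (by omega) hx2]
    exact hyval.trans ((hmax x hx2).trans (Nat.le_add_right _ _))
  by_cases hx3 : x = A + B
  · rw [hx3, compProfile_AB]; exact hyval
  by_cases hx4 : x = A + B + 1
  · rw [hx4, compProfile_AB_one]
    rcases hxy.lt_or_eq with hxy' | hxy'
    · rw [compProfile_eq_zero' (by omega)]; exact Nat.zero_le _
    · rw [← hxy', hx4, compProfile_AB_one]
  · rw [compProfile_eq_zero' (by omega : A + B + 2 ≤ x), compProfile_eq_zero' (by omega)]

/-- The largest level of the competitor (`A ≥ 1`). [cite: MaininiSchmidt2020, Corollary 4.8] -/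
theorem compProfile_zero (hA : 1 ≤ A) : compProfile A B P b c r U e 0 = c + e 0 := by
  simp only [compProfile]; rw [if_pos (by omega)]

/-- Block decomposition of sums over the competitor profile. [cite: MaininiSchmidt2020, Corollary 4.8] -/
theorem sum_compProfile (h : ℕ → ℕ) :
    ∑ i ∈ range (A + B + 2), h (compProfile A B P b c r U e i) =
      ∑ i ∈ range A, h (c + e i) +
        ∑ i ∈ range B, h (b + e (A + i) + if A + i < A + P then e (B + (A + i)) else 0) +
        (h (max r U) + h (min r U)) := by
  rw [show A + B + 2 = A + (B + 2) by ring, sum_range_add, sum_range_add, sum_range_succ,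
    sum_range_succ, sum_range_zero, zero_add]
  have h1 : ∀ i ∈ range A, h (compProfile A B P b c r U e i) = h (c + e i) := fun i hi => by
    simp only [compProfile]; rw [if_pos (mem_range.1 hi)]
  have h2 : ∀ i ∈ range B, h (compProfile A B P b c r U e (A + i)) =
      h (b + e (A + i) + if A + i < A + P then e (B + (A + i)) else 0) := fun i hi => by
    have hi := mem_range.1 hi
    simp only [compProfile]; rw [if_neg (by omega), if_pos (by omega)]
  have h3 : h (compProfile A B P b c r U e (A + (B + 0))) = h (max r U) := by
    simp only [compProfile]; rw [if_neg (by omega), if_neg (by omega), if_pos (by omega)]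
  have h4 : h (compProfile A B P b c r U e (A + (B + 1))) = h (min r U) := by
    simp only [compProfile]
    rw [if_neg (by omega), if_neg (by omega), if_neg (by omega), if_pos (by omega)]
  rw [sum_congr rfl h1, sum_congr rfl h2, h3, h4]
  ring

/-- Sums over a range of a function that vanishes beyond `P`. [folklore] -/
private theorem sum_range_ite_lt (h : ℕ → ℕ) {P B : ℕ} (hPB : P ≤ B) :
    ∑ i ∈ range B, (if i < P then h i else 0) = ∑ i ∈ range P, h i := by
  obtain ⟨c, rfl⟩ := Nat.exists_eq_add_of_le hPB
  rw [sum_range_add]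
  have h1 : ∀ i ∈ range P, (if i < P then h i else 0) = h i := fun i hi => by
    rw [if_pos (mem_range.1 hi)]
  have h2 : ∀ i ∈ range c, (if P + i < P then h (P + i) else 0) = 0 := fun i _ => by
    rw [if_neg (by omega)]
  rw [sum_congr rfl h1, sum_congr rfl h2, sum_const_zero, add_zero]

/-- The excess layers of the competitor are exactly those of the flat stack.
[cite: MaininiSchmidt2020, Corollary 4.8 (the points of F_2 are carried along)] -/
theorem sum_compProfile_excess (h : ℕ → ℕ) (h0 : h 0 = 0) (hPB : P ≤ B) :
    ∑ i ∈ range A, h (e i) + (∑ i ∈ range B, h (e (A + i)) +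
      ∑ i ∈ range B, h (if A + i < A + P then e (B + (A + i)) else 0)) =
      ∑ i ∈ range (A + B + P), h (e i) := by
  have h1 : ∑ i ∈ range B, h (if A + i < A + P then e (B + (A + i)) else 0) =
      ∑ i ∈ range B, (if i < P then h (e (A + B + i)) else 0) := by
    refine sum_congr rfl fun i _ => ?_
    by_cases hi : i < P
    · rw [if_pos (by omega), if_pos hi, show B + (A + i) = A + B + i by ring]
    · rw [if_neg (by omega), if_neg hi, h0]
  rw [h1, sum_range_ite_lt (fun i => h (e (A + B + i))) hPB, sum_range_add, sum_range_add]
  ring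

end CompProfile

/-- The arithmetic of the competitor: its levels have the same total number of points.
[folklore] -/
private theorem competitor_sum_arith (w p q B φ : ℕ) :
    (w + p * q + q) * (φ * (w + p * q + p)) + B * ((w + p * q) * φ) + φ * w =
      (w + p * q + q + B + p + 1) * ((w + p * q) * φ) := by
  ring

/-- The arithmetic of the competitor: its box-cost bounds add up to the cost of the flat stack. [folklore] -/
private theorem competitor_cost_arith (w p q B φ ψ : ℕ) :
    2 * (φ * (w + p * q + p)) + (w + p * q + q) * (2 * φ + (w + p * q + p) * ψ) +
        B * (2 * φ + (w + p * q) * ψ) + (2 * φ + w * ψ) =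
      2 * ((w + p * q) * φ) + (w + p * q + q + B + p + 1) * (2 * φ + (w + p * q) * ψ) := by
  ring

/-- **[MS20] Corollary 4.8 in value form — the cut-and-paste competitor.**  Dimension `d = k + 3`;
levels in `ℤ^{k+2}`; `b = [m,j]^{k+2} = m·φ`, `φ = [m,j]^{k+1}` (a short edge last).  Suppose an
optimal sorted profile with `T` levels is FLAT: its levels `i ≤ T − 2` have sizes `b + e_i` with a
non-increasing excess `e_i < φ` (a partial face layer — the lateral set `F_2` of (4.1)), the top
level being arbitrary.  Then for `p ≥ 2`, `q ≥ 1` with `pq = 2p''` even, `pq < m`,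
`T ≥ m + q + 2p + 3` and `4^{c_{k+2}} h_{m,k+2} ≤ pq` we get a contradiction: the profile with
`m + q` levels `φ(m+p) + e_i` (the `p` cut levels glued as a slab of thickness `p` onto a lateral
face, plus `q` levels receiving the `pq` carved `(d−2)`-slices), the untouched levels `b + e_i`
(`p + 1` of them also carrying the excess layers of the cut levels), the carved level
`U = φ(m − pq)` and the old top level has — by `eipValue_box_two_layers_le` — cost at most that of
the flat stack MINUS the gain `#Θ(U-box) − EIP^{k+2}(#U) ≥ 1` of Lemma 3.6 (`eipValue_deficientBox_lt`:
the upper face `U = {1,…,m−pq} × [m+1]^j × [m]^{k+1−j}` is a deficient box), contradicting optimality.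
[cite: MaininiSchmidt2020, Corollary 4.8 (proof) and Lemma 3.6] -/
theorem flat_profile_contradiction {m j : ℕ} (hm : 1 ≤ m) (hj : j + 1 ≤ k + 2)
    {T : ℕ} {f : ℕ → ℕ} (hf : IsOptProfile (k + 2) T f)
    (e : ℕ → ℕ) (he : Antitone e) (heφ : ∀ i, e i < pc m j (k + 1))
    (hlev : ∀ i, i < T - 1 → f i = pc m j (k + 2) + e i)
    {p q p'' : ℕ} (hp : 2 ≤ p) (hq : 1 ≤ q) (hpq : p * q = 2 * p'') (hp'' : 1 ≤ p'')
    (hpqm : p * q < m) (hT : m + q + 2 * p + 3 ≤ T) (hthr : slabThreshold (k + 2) m ≤ 2 * p'') :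
    False := by
  classical
  -- names: `φ`, `b = mφ`, `ψ = Φ(φ)`, `m = w + pq`, `T = A + B + p + 2`, `A = m + q`
  set φ := pc m j (k + 1) with hφ
  have hbφ : pc m j (k + 2) = m * φ := by rw [hφ, mul_pc m j (by omega)]
  have hφpos : 0 < φ := pc_pos hm _ _
  set ψ := eipValue (k + 1) φ with hψ
  obtain ⟨w, hw⟩ : ∃ w, m = w + p * q := ⟨m - p * q, by omega⟩
  have hw1 : 1 ≤ w := by omega
  obtain ⟨B, hB⟩ : ∃ B, T = (m + q) + B + p + 2 := ⟨T - (m + q + p + 2), by omega⟩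
  have hBp : p + 1 ≤ B := by omega
  set A := m + q with hA
  set r := f (T - 1) with hr
  -- the competitor
  set g := compProfile A B (p + 1) (m * φ) (φ * (m + p)) r (φ * w) e with hg
  have hrle : r ≤ m * φ + e (A + B + p) := by
    rw [hr, ← hbφ, ← hlev (A + B + p) (by omega)]; exact hf.antitone (by omega)
  have hUle : φ * w ≤ m * φ := by rw [hw]; nlinarith
  have hga : Antitone g :=
    compProfile_antitone (φ' := φ) (i₀ := A + B + p) he (fun i => (heφ i).le)
      (by nlinarith) (by omega) hrle hUle
  have hgT : g (A + B + 2) = 0 := compProfile_eq_zero' le_rfl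
  have hg0 : g 0 = φ * (m + p) + e 0 := compProfile_zero (by omega)
  -- total number of points
  have hN : ∑ i ∈ range T, f i = (T - 1) * (m * φ) + ∑ i ∈ range (T - 1), e i + r := by
    rw [show T = (T - 1) + 1 by omega, sum_range_succ, show T - 1 + 1 - 1 = T - 1 by omega, ← hr]
    have : ∀ i ∈ range (T - 1), f i = m * φ + e i := fun i hi => by
      rw [hlev i (mem_range.1 hi), hbφ]
    rw [sum_congr rfl this, sum_add_distrib, sum_const, card_range, smul_eq_mul]
  have hsumg : ∑ i ∈ range (A + B + 2), g i = ∑ i ∈ range T, f i := by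
    have hs := sum_compProfile (A := A) (B := B) (P := p + 1) (b := m * φ) (c := φ * (m + p))
      (r := r) (U := φ * w) (e := e) id
    simp only [id] at hs
    rw [hg, hs, sum_add_distrib, sum_add_distrib, sum_add_distrib, sum_const, sum_const, card_range,
      card_range, smul_eq_mul, smul_eq_mul, max_add_min, hN,
      show T - 1 = A + B + (p + 1) by omega]
    have hes0 := sum_compProfile_excess (A := A) (B := B) (P := p + 1) (e := e) id rfl hBp
    simp only [id] at hes0
    have key := competitor_sum_arith w p q B φ
    rw [← hw, ← hA] at key
    linarith [key, hes0]
  -- the competitor realises `N` with cost `≥ EIP^{k+3}(N) = cost of the flat stack`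
  obtain ⟨D, hD⟩ := exists_isNestedMinimizerFamily (d := k + 2) (by omega)
  have hreal := eipValue_succ_le_profileCost hD hga hgT
  rw [hsumg, ← hf.cost, profileCost_def, profileCost_def, hg0, hg,
    sum_compProfile (A := A) (B := B) (P := p + 1) (b := m * φ) (c := φ * (m + p))
      (r := r) (U := φ * w) (e := e) (eipValue (k + 2))] at hreal
  -- exact cost of the flat stack
  have horig : 2 * f 0 + ∑ i ∈ range T, eipValue (k + 2) (f i) =
      2 * (m * φ + e 0) + (T - 1) * (2 * φ + m * ψ) +
        ∑ i ∈ range (T - 1), eipValue (k + 1) (e i) + eipValue (k + 2) r := by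
    rw [hlev 0 (by omega), hbφ, show T = (T - 1) + 1 by omega, sum_range_succ,
      show T - 1 + 1 - 1 = T - 1 by omega, ← hr]
    have : ∀ i ∈ range (T - 1), eipValue (k + 2) (f i) =
        (2 * φ + m * ψ) + eipValue (k + 1) (e i) := fun i hi => by
      rw [hlev i (mem_range.1 hi), eipValue_pc_add_layer hm hj (heφ i).le]
    rw [sum_congr rfl this, sum_add_distrib, sum_const, card_range, smul_eq_mul]
    ring
  -- bounds of the blocks
  have hb1 : ∑ i ∈ range A, eipValue (k + 2) (φ * (m + p) + e i) ≤
      A * (2 * φ + (m + p) * ψ) + ∑ i ∈ range A, eipValue (k + 1) (e i) := by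
    have : ∀ i ∈ range A, eipValue (k + 2) (φ * (m + p) + e i) ≤
        (2 * φ + (m + p) * ψ) + eipValue (k + 1) (e i) := by
      intro i _
      have h := eipValue_box_two_layers_le (k := k) hm (by omega) p (heφ i).le (Nat.zero_le _)
        (e' := 0)
      rw [add_zero, eipValue_zero_right, add_zero, mul_comm (m + p) (pc m j (k + 1))] at h
      exact h
    refine (sum_le_sum this).trans (le_of_eq ?_)
    rw [sum_add_distrib, sum_const, card_range, smul_eq_mul]
  have hb2 : ∑ i ∈ range B, eipValue (k + 2)
        (m * φ + e (A + i) + if A + i < A + (p + 1) then e (B + (A + i)) else 0) ≤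
      B * (2 * φ + m * ψ) + (∑ i ∈ range B, eipValue (k + 1) (e (A + i)) +
        ∑ i ∈ range B, eipValue (k + 1) (if A + i < A + (p + 1) then e (B + (A + i)) else 0)) := by
    have : ∀ i ∈ range B, eipValue (k + 2)
          (m * φ + e (A + i) + if A + i < A + (p + 1) then e (B + (A + i)) else 0) ≤
        2 * φ + m * ψ + eipValue (k + 1) (e (A + i)) +
          eipValue (k + 1) (if A + i < A + (p + 1) then e (B + (A + i)) else 0) := by
      intro i _
      have h := eipValue_box_two_layers_le (k := k) hm (by omega) 0 (heφ (A + i)).le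
        (e' := if A + i < A + (p + 1) then e (B + (A + i)) else 0)
        (by split_ifs; exacts [(heφ _).le, Nat.zero_le _])
      rw [add_zero] at h
      exact h
    refine (sum_le_sum this).trans (le_of_eq ?_)
    rw [sum_add_distrib, sum_add_distrib, sum_const, card_range, smul_eq_mul, add_assoc]
  -- the strict gain at the carved level `U` ([MS20] Lemma 3.6)
  have hU' : eipValue (k + 2) (φ * w) < 2 * φ + w * ψ := by
    have h := eipValue_deficientBox_lt k m j p'' hp'' (by omega) hthr
    obtain ⟨hc1, hc2⟩ :=
      card_deficientBox_and_perim (ℓ := m) (q := 2 * p'') (by omega) k j (by omega)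
    rw [hc1, hc2, ← hpq, ← hφ, show m - p * q = w by omega] at h
    rw [hψ, eipValue_eq_cubicleCost (d := k + 1) (by omega), hφ,
      cubicleCost_pc_le_succ hm (by omega), mul_comm]
    exact h
  have hUr : eipValue (k + 2) (max r (φ * w)) + eipValue (k + 2) (min r (φ * w)) =
      eipValue (k + 2) r + eipValue (k + 2) (φ * w) := by
    rcases le_total r (φ * w) with h | h
    · rw [max_eq_right h, min_eq_left h, add_comm]
    · rw [max_eq_left h, min_eq_right h]
  have hes := sum_compProfile_excess (A := A) (B := B) (P := p + 1) (e := e) (eipValue (k + 1))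
    (eipValue_zero_right _) hBp
  have key := competitor_cost_arith w p q B φ ψ
  rw [← hw, ← hA] at key
  rw [horig, hUr, show T - 1 = A + B + (p + 1) by omega] at hreal
  rw [show A + B + p + 1 = A + B + (p + 1) by ring] at key
  linarith [hreal, hb1, hb2, hU', hes, key]

end Competitor


/-! ### The level-count bound for flat profiles ([MS20] Corollary 4.8: `a_d − ℓ ≤ 4^{c_d} h_{ℓ,d} + 6`) -/

section LevelBound

variable {k : ℕ}

/-- **[MS20] Corollary 4.8, combinatorial form.**  For a flat optimal profile (as in
`flat_profile_contradiction`) and every `t ≥ 1` with `4t² < m` and `4^{c} h_{m} ≤ 4t²`: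
`T ≤ m + 6t + 2` (take `p = q = 2t`). [cite: MaininiSchmidt2020, Corollary 4.8] -/
theorem flat_levels_le {m j : ℕ} (hm : 1 ≤ m) (hj : j + 1 ≤ k + 2)
    {T : ℕ} {f : ℕ → ℕ} (hf : IsOptProfile (k + 2) T f)
    (e : ℕ → ℕ) (he : Antitone e) (heφ : ∀ i, e i < pc m j (k + 1))
    (hlev : ∀ i, i < T - 1 → f i = pc m j (k + 2) + e i)
    {t : ℕ} (ht : 1 ≤ t) (htm : 4 * t ^ 2 < m) (hthr : slabThreshold (k + 2) m ≤ 4 * (t : ℝ) ^ 2) :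
    T ≤ m + 6 * t + 2 := by
  by_contra hT
  refine flat_profile_contradiction hm hj hf e he heφ hlev (p := 2 * t) (q := 2 * t)
    (p'' := 2 * t ^ 2) (by omega) (by omega) (by ring) (by nlinarith) (by nlinarith) (by omega) ?_
  push_cast
  nlinarith [hthr]

/-- The threshold is at most `4 h²` with `h = m^{2^{−(k+2)}}`:
`4^{c_{k+2}} m^{2^{1−(k+2)}} ≤ 4 (m^{2^{−(k+2)}})²`. [cite: MaininiSchmidt2020, Definition 3.1 and Lemma 3.6] -/
theorem slabThreshold_le_four_mul_sq (k m : ℕ) :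
    slabThreshold (k + 2) m ≤ 4 * ((m : ℝ) ^ ((2 : ℝ) ^ (-((k : ℝ) + 2)))) ^ 2 := by
  unfold slabThreshold
  have hm : (0 : ℝ) ≤ m := Nat.cast_nonneg m
  have h4 : (4 : ℝ) ^ (1 - (2 : ℝ) ^ (1 - ((k + 2 : ℕ) : ℝ))) ≤ 4 := by
    have h2pos : (0 : ℝ) < (2 : ℝ) ^ (1 - ((k + 2 : ℕ) : ℝ)) := Real.rpow_pos_of_pos (by norm_num) _
    calc (4 : ℝ) ^ (1 - (2 : ℝ) ^ (1 - ((k + 2 : ℕ) : ℝ))) ≤ (4 : ℝ) ^ (1 : ℝ) :=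
          Real.rpow_le_rpow_of_exponent_le (by norm_num) (by linarith)
      _ = 4 := Real.rpow_one _
  have hsq : ((m : ℝ) ^ ((2 : ℝ) ^ (-((k : ℝ) + 2)))) ^ 2 = (m : ℝ) ^ ((2 : ℝ) ^ (1 - ((k + 2 : ℕ) : ℝ))) := by
    rw [← Real.rpow_natCast, ← Real.rpow_mul hm]
    congr 1
    push_cast
    rw [show (1 : ℝ) - ((k : ℝ) + 2) = -((k : ℝ) + 2) + 1 by ring, Real.rpow_add (by norm_num : (0:ℝ) < 2),
      Real.rpow_one]
  rw [hsq]
  exact mul_le_mul_of_nonneg_right h4 (by positivity)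

/-- `m^{2^{−(k+2)}} ≤ m^{1/4}` for `m ≥ 1`. [cite: MaininiSchmidt2020, Definition 3.1] -/
theorem rpow_h_le_rpow_quarter (k : ℕ) {m : ℕ} (hm : 1 ≤ m) :
    (m : ℝ) ^ ((2 : ℝ) ^ (-((k : ℝ) + 2))) ≤ (m : ℝ) ^ ((1 : ℝ) / 4) := by
  refine Real.rpow_le_rpow_of_exponent_le (by exact_mod_cast hm) ?_
  calc (2 : ℝ) ^ (-((k : ℝ) + 2)) ≤ (2 : ℝ) ^ (-(2 : ℝ)) :=
        Real.rpow_le_rpow_of_exponent_le (by norm_num) (by have : (0:ℝ) ≤ k := Nat.cast_nonneg k; linarith)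
    _ = 1 / 4 := by
        rw [Real.rpow_neg (by norm_num), show (2 : ℝ) = ((2 : ℕ) : ℝ) by norm_num, Real.rpow_natCast]
        norm_num

/-- **Choice of the parameter `t`** for `m ≥ 4097`: with `t = ⌊√⌈4^c h_m⌉⌋ + 1` one has `t ≥ 1`,
`4^{c} h_{m} ≤ 4t²`, `4t² < m` and `t ≤ 2 m^{2^{−(k+2)}} + 2`. [cite: MaininiSchmidt2020, Corollary 4.8 (p = ⌊(a_d − ℓ)/2⌋)] -/
theorem exists_good_t (k : ℕ) {m : ℕ} (hm : 4097 ≤ m) :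
    ∃ t : ℕ, 1 ≤ t ∧ 4 * t ^ 2 < m ∧ slabThreshold (k + 2) m ≤ 4 * (t : ℝ) ^ 2 ∧
      (t : ℝ) ≤ 2 * (m : ℝ) ^ ((2 : ℝ) ^ (-((k : ℝ) + 2))) + 2 := by
  set θ := slabThreshold (k + 2) m with hθ
  have hθ0 : 0 ≤ θ := slabThreshold_nonneg _ _
  set s := ⌈θ⌉₊ with hs
  set t := Nat.sqrt s + 1 with ht
  set h := (m : ℝ) ^ ((2 : ℝ) ^ (-((k : ℝ) + 2))) with hh
  have hh0 : 0 ≤ h := by positivity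
  have hm1 : (1 : ℝ) ≤ m := by exact_mod_cast (show 1 ≤ m by omega)
  have hh1 : 1 ≤ h := Real.one_le_rpow hm1 (by positivity)
  -- `θ ≤ s < t²`
  have h1 : θ ≤ (t : ℝ) ^ 2 := by
    have a : θ ≤ s := Nat.le_ceil θ
    have b : s < t ^ 2 := by rw [ht]; exact Nat.lt_succ_sqrt' s
    have b' : (s : ℝ) ≤ (t : ℝ) ^ 2 := by exact_mod_cast b.le
    linarith
  -- `t ≤ √θ + 2 ≤ 2h + 2`
  have hθh : θ ≤ 4 * h ^ 2 := slabThreshold_le_four_mul_sq k m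
  have h2 : (t : ℝ) ≤ 2 * h + 2 := by
    have a : ((Nat.sqrt s : ℕ) : ℝ) ^ 2 ≤ s := by exact_mod_cast Nat.sqrt_le' s
    have b : (s : ℝ) < θ + 1 := by rw [hs]; exact Nat.ceil_lt_add_one hθ0
    have c : ((Nat.sqrt s : ℕ) : ℝ) ^ 2 < (2 * h + 1) ^ 2 := by nlinarith
    have d : ((Nat.sqrt s : ℕ) : ℝ) < 2 * h + 1 := by
      nlinarith [Nat.cast_nonneg (α := ℝ) (Nat.sqrt s)]
    rw [ht]; push_cast; linarith
  refine ⟨t, by omega, ?_, h1.trans (by nlinarith), h2⟩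
  -- `4t² ≤ 16(h+1)² ≤ 64 m^{1/2} < m`
  have hq := rpow_h_le_rpow_quarter k (show 1 ≤ m by omega)
  rw [← hh] at hq
  set r4 := (m : ℝ) ^ ((1 : ℝ) / 4) with hr4
  have hr4sq : r4 ^ 4 = m := by
    rw [hr4, ← Real.rpow_natCast, ← Real.rpow_mul (by positivity)]; norm_num
  have hr41 : 1 ≤ r4 := Real.one_le_rpow hm1 (by norm_num)
  have hr4big : 8 < r4 := by
    by_contra hc
    push Not at hc
    have : r4 ^ 4 ≤ 8 ^ 4 := by
      exact pow_le_pow_left₀ (by linarith) hc 4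
    rw [hr4sq] at this
    have : (m : ℝ) ≤ 4096 := by linarith
    have : m ≤ 4096 := by exact_mod_cast this
    omega
  have key : (4 * t ^ 2 : ℕ) < (m : ℝ) := by
    push_cast
    have e1 : (t : ℝ) ≤ 2 * r4 + 2 := h2.trans (by linarith)
    have e2 : (0 : ℝ) ≤ t := Nat.cast_nonneg t
    have e3 : (t : ℝ) ^ 2 ≤ (2 * r4 + 2) ^ 2 := pow_le_pow_left₀ e2 e1 2
    have e4 : (2 * r4 + 2) ^ 2 ≤ 16 * r4 ^ 2 := by nlinarith
    have e5 : 64 * r4 ^ 2 < r4 ^ 4 := by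
      have hr2 : 64 < r4 ^ 2 := by nlinarith
      have hpos : 0 < r4 ^ 2 := by positivity
      calc 64 * r4 ^ 2 < r4 ^ 2 * r4 ^ 2 := mul_lt_mul_of_pos_right hr2 hpos
        _ = r4 ^ 4 := by ring
    nlinarith
  exact_mod_cast key

/-- **[MS20] Corollary 4.8 for flat profiles, large `m`**: `T ≤ m + 12 m^{2^{−(k+2)}} + 14`.
[cite: MaininiSchmidt2020, Corollary 4.8] -/
theorem flat_levels_le_real {m j : ℕ} (hm : 4097 ≤ m) (hj : j + 1 ≤ k + 2)
    {T : ℕ} {f : ℕ → ℕ} (hf : IsOptProfile (k + 2) T f)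
    (e : ℕ → ℕ) (he : Antitone e) (heφ : ∀ i, e i < pc m j (k + 1))
    (hlev : ∀ i, i < T - 1 → f i = pc m j (k + 2) + e i) :
    (T : ℝ) ≤ m + 12 * (m : ℝ) ^ ((2 : ℝ) ^ (-((k : ℝ) + 2))) + 14 := by
  obtain ⟨t, ht1, htm, hthr, htle⟩ := exists_good_t k hm
  have h := flat_levels_le (by omega) hj hf e he heφ hlev ht1 htm hthr
  have h' : (T : ℝ) ≤ m + 6 * t + 2 := by exact_mod_cast h
  linarith

end LevelBound


/-! ### Crude bounds: few levels when all levels are small; the planar case -/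

section Crude

variable {n : ℕ}

/-- `2(n+1) ≤ EIP^{n+1}(x)` for `x ≥ 1` (from the Loomis–Whitney bound `2d #A^{(d−1)/d} ≤ #Θ_d(A)`).
[cite: LoomisWhitney1949, Theorem 2; MaininiSchmidt2020, (2.3)] -/
theorem two_mul_le_eipValue (n : ℕ) {x : ℕ} (hx : 1 ≤ x) : 2 * (n + 1) ≤ eipValue (n + 1) x := by
  obtain ⟨A, hA, hAx⟩ := exists_isEIPMinimizer_card_eq n x
  have hne : A.Nonempty := by rw [← card_pos, hAx]; exact hx
  have h := two_mul_card_mul_rpow_le_card_boundaryPairs (by omega) A hne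
  rw [hA.card_boundaryPairs_eq hAx, hAx] at h
  have h1 : (1 : ℝ) ≤ (x : ℝ) ^ ((((n + 1 : ℕ) : ℝ) - 1) / ((n + 1 : ℕ) : ℝ)) :=
    Real.one_le_rpow (by exact_mod_cast hx) (by
      apply div_nonneg <;> push_cast <;> linarith [Nat.cast_nonneg (α := ℝ) n])
  have h2 : (2 : ℝ) * ((n + 1 : ℕ) : ℝ) ≤ eipValue (n + 1) x := by
    have := mul_le_mul_of_nonneg_left h1 (by positivity : (0 : ℝ) ≤ 2 * ((n + 1 : ℕ) : ℝ))
    linarith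
  exact_mod_cast h2

/-- `EIP^d(x) ≤ 2d·x` (every point has `2d` neighbours). [cite: MaininiSchmidt2020, §1 (#Θ_d + 2b = 2d #C)] -/
theorem eipValue_le_two_mul (n x : ℕ) : eipValue (n + 1) x ≤ 2 * (n + 1) * x := by
  obtain ⟨A, hA, hAx⟩ := exists_isEIPMinimizer_card_eq n x
  have h := card_boundaryPairs_add_card_adjPairs A
  rw [hA.card_boundaryPairs_eq hAx, hAx] at h
  omega

/-- **Few levels when all levels are small**: an optimal sorted profile over `ℤ^{n+1}` whose levels
have at most `M₀` points has at most `3 (4(n+1)M₀)^{n+1}` levels — compare with the stack of cubes of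
side `4(n+1)M₀` (each level costs at least `2(n+1)`, a cube level `u^{n+1}` costs `2(n+1)u^n`).
[cite: MaininiSchmidt2020, Theorem 1.1 (i) (the case of bounded ℓ); AgnarssonLauria2013, Proposition 3.2] -/
theorem IsOptProfile.le_of_levels_le {T : ℕ} {f : ℕ → ℕ} (hf : IsOptProfile (n + 1) T f) {M₀ : ℕ}
    (hM₀ : 1 ≤ M₀) (hM : ∀ i, f i ≤ M₀) : T ≤ 3 * (4 * (n + 1) * M₀) ^ (n + 1) := by
  classical
  set u := 4 * (n + 1) * M₀ with hu
  set Δ := u ^ (n + 1) with hΔ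
  have hu1 : 4 * (n + 1) ≤ u := by rw [hu]; nlinarith
  have hΔu : Δ = u * u ^ n := by rw [hΔ, pow_succ, mul_comm]
  have hΔ1 : 1 ≤ Δ := Nat.one_le_pow _ _ (by omega)
  set N := ∑ i ∈ range T, f i with hN
  have hNT : T ≤ N := by
    have : ∑ i ∈ range T, 1 ≤ N := sum_le_sum fun i hi => hf.pos i (mem_range.1 hi)
    simpa using this
  have hNM : N ≤ T * M₀ := by
    have : N ≤ ∑ i ∈ range T, M₀ := sum_le_sum fun i _ => hM i
    simpa [mul_comm] using this
  by_cases hsmall : N < Δ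
  · omega
  push Not at hsmall
  obtain ⟨D, hD⟩ := exists_isNestedMinimizerFamily (d := n + 1) (by omega)
  set c := N / Δ with hc
  set v := N % Δ with hv
  have hcv : Δ * c + v = N := Nat.div_add_mod N Δ
  have hc1 : 1 ≤ c := Nat.div_pos hsmall (by omega)
  have hvΔ : v < Δ := Nat.mod_lt _ (by omega)
  -- upper bound from the cube stack
  have hup : eipValue (n + 2) N ≤ 2 * Δ + c * eipValue (n + 1) Δ + eipValue (n + 1) v := by
    rw [← hcv, mul_comm Δ c]
    exact eipValue_succ_mul_add_le hD hc1 hvΔ.le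
  have hcube : eipValue (n + 1) Δ = 2 * ((n + 1) * u ^ n) := by
    rw [hΔ]; exact eipValue_pow_succ n (by omega)
  have hvle : eipValue (n + 1) v ≤ 2 * (n + 1) * Δ :=
    (eipValue_le_two_mul n v).trans (Nat.mul_le_mul_left _ hvΔ.le)
  -- lower bound: every level costs at least `2(n+1)`
  have hlow : 2 * (n + 1) * T ≤ eipValue (n + 2) N := by
    rw [hN, ← hf.cost, profileCost_def]
    have : ∑ i ∈ range T, 2 * (n + 1) ≤ ∑ i ∈ range T, eipValue (n + 1) (f i) :=
      sum_le_sum fun i hi => two_mul_le_eipValue n (hf.pos i (mem_range.1 hi))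
    rw [sum_const, card_range, smul_eq_mul] at this
    linarith
  -- `4(n+1) c u^n ≤ T`
  have hcT : 4 * (n + 1) * c * u ^ n ≤ T := by
    have h1 : c * Δ ≤ T * M₀ := by rw [mul_comm]; omega
    rw [hΔu, hu] at h1
    have h2 : (4 * (n + 1) * c * u ^ n) * M₀ ≤ T * M₀ := by
      calc (4 * (n + 1) * c * u ^ n) * M₀ = c * (4 * (n + 1) * M₀ * u ^ n) := by ring
        _ ≤ T * M₀ := h1
    exact Nat.le_of_mul_le_mul_right h2 hM₀
  have hnu : 4 * (n + 1) * u ^ n ≤ Δ := by rw [hΔu]; exact Nat.mul_le_mul_right _ hu1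
  rw [hcube] at hup
  nlinarith [hup, hvle, hlow, hcT, hnu]

/-- **The planar case** (`d = 2`): an optimal sorted profile over `ℤ¹` with `T` levels and `N`
points has `T ≤ √N + 2N^{1/4}` — from `EIP²(N) = 2⌈2√N⌉ = 2(f_0 + T)` and `N ≤ T f_0`.
[cite: MaininiPiovanoSchmidtStefanelli2019, Theorem 1.2 (d = 2, quasi-squares); MaininiSchmidt2020, Theorem 1.1 (i), d = 2] -/
theorem IsOptProfile.planar_le {T : ℕ} {f : ℕ → ℕ} (hf : IsOptProfile 1 T f) :
    (T : ℝ) ≤ ((∑ i ∈ range T, f i : ℕ) : ℝ) ^ ((1 : ℝ) / 2) +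
      2 * ((∑ i ∈ range T, f i : ℕ) : ℝ) ^ ((1 : ℝ) / 4) := by
  classical
  set N := ∑ i ∈ range T, f i with hN
  rcases Nat.eq_zero_or_pos T with hT | hT
  · rw [hT]; push_cast; positivity
  set H := halfPerim N with hH
  -- `f 0 + T = H`
  have hcost : f 0 + T = H := by
    have h := hf.cost
    rw [profileCost_def, eipValue_two, ← hN] at h
    have : ∑ i ∈ range T, eipValue 1 (f i) = ∑ i ∈ range T, 2 :=
      sum_congr rfl fun i hi => eipValue_one (hf.pos i (mem_range.1 hi))
    rw [this, sum_const, card_range, smul_eq_mul] at h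
    omega
  have hf0 : 1 ≤ f 0 := hf.pos 0 hT
  -- `N ≤ T f 0`
  have hNle : N ≤ T * f 0 := by
    have : N ≤ ∑ i ∈ range T, f 0 := sum_le_sum fun i _ => hf.antitone (Nat.zero_le i)
    simpa [mul_comm] using this
  have hN1 : 1 ≤ N := by
    have : f 0 ≤ N := by
      rw [hN]; exact single_le_sum (f := f) (fun i _ => Nat.zero_le _) (mem_range.2 hT)
    omega
  -- `(H - 1)² < 4N + 1`, i.e. `H ≤ 2√N + 1`
  have hH1 : 1 ≤ H := by omega
  have hq : qsq (H - 1) < N := qsq_lt_of_lt_halfPerim (by omega)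
  have hsq := sq_le_four_mul_qsq_add_one (H - 1)
  have hHr : ((H : ℝ) - 1) ^ 2 ≤ 4 * N := by
    have : (H - 1) ^ 2 ≤ 4 * N := by omega
    have h' : (((H - 1 : ℕ) : ℝ)) ^ 2 ≤ 4 * N := by exact_mod_cast this
    rwa [Nat.cast_sub hH1, Nat.cast_one] at h'
  -- real arithmetic
  set x := (N : ℝ) ^ ((1 : ℝ) / 4) with hx
  have hx0 : 0 ≤ x := by positivity
  have hx1 : 1 ≤ x := Real.one_le_rpow (by exact_mod_cast hN1) (by norm_num)
  have hx2 : x ^ 2 = (N : ℝ) ^ ((1 : ℝ) / 2) := by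
    rw [hx, ← Real.rpow_natCast, ← Real.rpow_mul (Nat.cast_nonneg N)]; norm_num
  have hx4 : x ^ 4 = N := by
    rw [hx, ← Real.rpow_natCast, ← Real.rpow_mul (Nat.cast_nonneg N)]; norm_num
  rw [← hx2]
  have hHx : (H : ℝ) ≤ 2 * x ^ 2 + 1 := by nlinarith
  have hTf : (N : ℝ) ≤ T * f 0 := by exact_mod_cast hNle
  have hc : ((f 0 : ℕ) : ℝ) + T = H := by exact_mod_cast hcost
  -- `(2T − H)² ≤ H² − 4N ≤ 4x² + 1 ≤ (2x+1)²`
  have h1 : (2 * (T : ℝ) - H) ^ 2 ≤ 4 * x ^ 2 + 1 := by nlinarith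
  have h2 : 2 * (T : ℝ) - H ≤ 2 * x + 1 := by
    have : (2 * (T : ℝ) - H) ^ 2 ≤ (2 * x + 1) ^ 2 := by nlinarith
    exact abs_le_of_sq_le_sq' this (by positivity) |>.2
  nlinarith

end Crude


/-! ### Assembly: the level-count bound `LEVELS_d` and [MS20] Theorem 1.1 (i) -/

section Assembly

/-- `x ≤ y^{1/d}` from `x^d ≤ y`. [folklore] -/
private theorem cast_le_rpow_inv_of_pow_le {x y d : ℕ} (hd : d ≠ 0) (h : x ^ d ≤ y) :
    (x : ℝ) ≤ (y : ℝ) ^ ((1 : ℝ) / d) := by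
  have h' : ((x : ℝ) ^ d) ≤ (y : ℝ) := by exact_mod_cast h
  calc (x : ℝ) = ((x : ℝ) ^ d) ^ ((1 : ℝ) / d) := by
        rw [one_div, Real.pow_rpow_inv_natCast (Nat.cast_nonneg x) hd]
    _ ≤ (y : ℝ) ^ ((1 : ℝ) / d) := Real.rpow_le_rpow (by positivity) h' (by positivity)

/-- **`LEVELS_d` for `d = k + 3 ≥ 3`**: an optimal sorted profile over `ℤ^{k+2}` with `N` points has at
most `N^{1/d} + K_d N^{2^{1−d}/d}` levels.  Proof ([MS20] §4 in value form): flatten the profile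
(`IsOptProfile.flatten`, Lemma 4.7), then either the stack is short (`T − 1 ≤ ℓ`, trivial), or `ℓ` is
small (crude bound), or Corollary 4.8 (`flat_levels_le_real`) applies.
[cite: MaininiSchmidt2020, Theorem 1.1 (i) via Lemma 4.7 and Corollary 4.8] -/
theorem IsOptProfile.levels_le_rpow (k : ℕ) : ∃ K : ℝ, ∀ (T : ℕ) (f : ℕ → ℕ),
    IsOptProfile (k + 2) T f →
      (T : ℝ) ≤ ((∑ i ∈ range T, f i : ℕ) : ℝ) ^ ((1 : ℝ) / ((k + 3 : ℕ) : ℝ)) +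
        K * ((∑ i ∈ range T, f i : ℕ) : ℝ) ^ ((2 : ℝ) ^ (1 - ((k + 3 : ℕ) : ℝ)) / ((k + 3 : ℕ) : ℝ)) := by
  classical
  set Cs : ℕ := 3 * (4 * (k + 1 + 1) * 4097 ^ (k + 2)) ^ (k + 1 + 1) with hCs
  refine ⟨26 + Cs, fun T f hf => ?_⟩
  set N := ∑ i ∈ range T, f i with hN
  set d := k + 3 with hd
  have hβ : (2 : ℝ) ^ (1 - ((k + 3 : ℕ) : ℝ)) = (2 : ℝ) ^ (-((k : ℝ) + 2)) := by
    push_cast; ring_nf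
  have hrpow0 : 0 ≤ (N : ℝ) ^ ((1 : ℝ) / ((k + 3 : ℕ) : ℝ)) := by positivity
  have hrpow0' : 0 ≤ (N : ℝ) ^ ((2 : ℝ) ^ (1 - ((k + 3 : ℕ) : ℝ)) / ((k + 3 : ℕ) : ℝ)) := by positivity
  have hCs0 : (0 : ℝ) ≤ Cs := Nat.cast_nonneg Cs
  rcases Nat.eq_zero_or_pos T with hT0 | hTpos
  · rw [hT0]; push_cast; nlinarith
  -- `N ≥ 1`, so the correction term is `≥ 1`
  set M := f 0 with hM
  have hM1 : 1 ≤ M := hf.pos 0 hTpos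
  have hMN : M ≤ N := by
    rw [hN, hM]; exact single_le_sum (f := f) (fun i _ => Nat.zero_le _) (mem_range.2 hTpos)
  have hN1 : (1 : ℝ) ≤ N := by exact_mod_cast hM1.trans hMN
  have hone : 1 ≤ (N : ℝ) ^ ((2 : ℝ) ^ (1 - ((k + 3 : ℕ) : ℝ)) / ((k + 3 : ℕ) : ℝ)) :=
    Real.one_le_rpow hN1 (by positivity)
  -- the pseudo-cubic representation of the largest level
  have hk2 : 1 ≤ k + 2 := by omega
  set m := iroot (k + 2) M with hm
  set j := plead (k + 2) M with hj
  have hm1 : 1 ≤ m := iroot_pos hk2 hM1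
  have hjk : j ≤ k + 1 := by have := plead_le (k + 2) M; omega
  have hbM : pc m j (k + 2) ≤ M := pc_plead_le hk2 M
  have hMlt : M < pc m j (k + 2) + pc m j (k + 1) := by
    have h := lt_pc_plead_succ hk2 M
    rw [← hm, ← hj, pc_succ m j (show j + 1 ≤ k + 2 by omega)] at h
    exact h
  -- flatten
  obtain ⟨f', hf', hsum', hf'0, hmax⟩ := IsOptProfile.flatten (n := k + 2) hk2 hm1
    (show j + 1 ≤ k + 2 by omega) T T f hf hbM ((card_filter_le _ _).trans (by simp))
  set b := pc m j (k + 2) with hb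
  have hf'le : ∀ i, f' i ≤ M := by
    intro i
    rcases Nat.lt_or_ge i (T - 1) with hi | hi
    · rw [hmax i hi]; exact max_le (hf.antitone (Nat.zero_le i)) hbM
    · rcases Nat.lt_or_ge i T with hi' | hi'
      · have : i = T - 1 := by omega
        calc f' i ≤ f' 0 := hf'.antitone (Nat.zero_le i)
          _ = M := hf'0
      · rw [hf'.eq_zero i hi']; exact Nat.zero_le _
  have hf'ge : ∀ i, i < T - 1 → b ≤ f' i := fun i hi => by rw [hmax i hi]; exact le_max_right _ _
  set e : ℕ → ℕ := fun i => if i < T - 1 then f' i - b else 0 with he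
  have hea : Antitone e := by
    intro a c hac
    show e c ≤ e a
    simp only [he]
    by_cases hc : c < T - 1
    · rw [if_pos hc, if_pos (by omega)]
      exact Nat.sub_le_sub_right (hf'.antitone hac) _
    · rw [if_neg hc]; exact Nat.zero_le _
  have heφ : ∀ i, e i < pc m j (k + 1) := by
    intro i
    simp only [he]
    split_ifs with hi
    · have := hf'le i; omega
    · exact pc_pos hm1 _ _
  have hlev : ∀ i, i < T - 1 → f' i = pc m j (k + 2) + e i := by
    intro i hi
    simp only [he]; rw [if_pos hi]; have := hf'ge i hi; omega
  -- `N ≥ (T - 1) b`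
  have hNb : (T - 1) * b ≤ N := by
    rw [hN, ← hsum']
    have h1 : ∑ i ∈ range (T - 1), b ≤ ∑ i ∈ range (T - 1), f' i :=
      sum_le_sum fun i hi => hf'ge i (mem_range.1 hi)
    rw [sum_const, card_range, smul_eq_mul] at h1
    have h2 : ∑ i ∈ range (T - 1), f' i ≤ ∑ i ∈ range T, f' i :=
      sum_le_sum_of_subset (range_subset_range.2 (by omega))
    exact h1.trans h2
  have hbm : m ^ (k + 2) ≤ b := pow_le_pc m (by omega)
  -- Case (i): short stacks
  by_cases hshort : T - 1 ≤ m
  · have hpow : (T - 1) ^ (k + 3) ≤ N := by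
      calc (T - 1) ^ (k + 3) = (T - 1) * (T - 1) ^ (k + 2) := by ring
        _ ≤ (T - 1) * m ^ (k + 2) := Nat.mul_le_mul_left _ (Nat.pow_le_pow_left hshort _)
        _ ≤ (T - 1) * b := Nat.mul_le_mul_left _ hbm
        _ ≤ N := hNb
    have h1 := cast_le_rpow_inv_of_pow_le (by omega : k + 3 ≠ 0) hpow
    rw [Nat.cast_sub (by omega : 1 ≤ T), Nat.cast_one] at h1
    nlinarith
  push Not at hshort
  -- `m ≤ N^{1/d}`
  have hmpow : m ^ (k + 3) ≤ N := by
    calc m ^ (k + 3) = m * m ^ (k + 2) := by ring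
      _ ≤ (T - 1) * b := Nat.mul_le_mul hshort.le hbm
      _ ≤ N := hNb
  have hmN := cast_le_rpow_inv_of_pow_le (by omega : k + 3 ≠ 0) hmpow
  by_cases hsmallm : m ≤ 4096
  · -- Case (ii): crude bound
    have hM₀ : ∀ i, f' i ≤ 4097 ^ (k + 2) := by
      intro i
      refine (hf'le i).trans ?_
      have h1 : pc m j (k + 2) + pc m j (k + 1) = pc m (j + 1) (k + 2) :=
        (pc_succ m j (show j + 1 ≤ k + 2 by omega)).symm
      have h2 := pc_le_succ_pow m (show j + 1 ≤ k + 2 by omega)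
      have h3 : (m + 1) ^ (k + 2) ≤ 4097 ^ (k + 2) := Nat.pow_le_pow_left (by omega) _
      omega
    have hT := hf'.le_of_levels_le (n := k + 1) (M₀ := 4097 ^ (k + 2)) (Nat.one_le_pow _ _ (by omega)) hM₀
    have hT' : (T : ℝ) ≤ Cs := by rw [hCs]; exact_mod_cast hT
    nlinarith
  · -- Case (iii): [MS20] Corollary 4.8
    push Not at hsmallm
    have h := flat_levels_le_real (k := k) (by omega : 4097 ≤ m) (show j + 1 ≤ k + 2 by omega)
      hf' e hea heφ hlev
    have hh : (m : ℝ) ^ ((2 : ℝ) ^ (-((k : ℝ) + 2))) ≤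
        (N : ℝ) ^ ((2 : ℝ) ^ (1 - ((k + 3 : ℕ) : ℝ)) / ((k + 3 : ℕ) : ℝ)) := by
      rw [hβ, div_eq_mul_one_div, mul_comm, Real.rpow_mul (Nat.cast_nonneg N)]
      exact Real.rpow_le_rpow (Nat.cast_nonneg m) hmN (by positivity)
    nlinarith

/-- **`LEVELS_2`** (the planar case) in the same form. [cite: MaininiSchmidt2020, Theorem 1.1 (i), d = 2] -/
theorem IsOptProfile.levels_le_rpow_two : ∃ K : ℝ, ∀ (T : ℕ) (f : ℕ → ℕ), IsOptProfile 1 T f →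
    (T : ℝ) ≤ ((∑ i ∈ range T, f i : ℕ) : ℝ) ^ ((1 : ℝ) / ((2 : ℕ) : ℝ)) +
      K * ((∑ i ∈ range T, f i : ℕ) : ℝ) ^ ((2 : ℝ) ^ (1 - ((2 : ℕ) : ℝ)) / ((2 : ℕ) : ℝ)) := by
  refine ⟨2, fun T f hf => ?_⟩
  have h := hf.planar_le
  have e1 : (1 : ℝ) / ((2 : ℕ) : ℝ) = (1 : ℝ) / 2 := by norm_num
  have e2 : (2 : ℝ) ^ (1 - ((2 : ℕ) : ℝ)) / ((2 : ℕ) : ℝ) = (1 : ℝ) / 4 := by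
    rw [show (1 : ℝ) - ((2 : ℕ) : ℝ) = -1 by norm_num, Real.rpow_neg_one]; norm_num
  rw [e1, e2]; exact h

/-- **[MS20] Theorem 1.1 (i) — DISCHARGED.**  `MaininiSchmidt2020_thm11_upper` holds: for every
`d ≥ 1` there is `K_d` with `min_a #(C △ (a + W_n)) ≤ K_d n^{(d−1+2^{1−d})/d}` for every minimizer
`C` of `EIP^d_n`.  The proof runs through `MaininiSchmidt2020_thm11_upper_of_levelBound`
(file `EIPMinimizerExtent`: symmetrization + box counting, [MS20] Theorem 4.9 / Lemma 4.10 replaced by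
the elementary count) and the level bound `LEVELS_d` above ([MS20] Lemma 4.7 + Corollary 4.8 in
value form, with [MS20] Lemma 3.6 = `EIPSlabConverse`).
[cite: MaininiSchmidt2020, Theorem 1.1 (i)] -/
theorem MaininiSchmidt2020_thm11_upper_holds : MaininiSchmidt2020_thm11_upper := by
  refine MaininiSchmidt2020_thm11_upper_of_levelBound fun d hd => ?_
  obtain ⟨k, rfl⟩ : ∃ k, d = k + 2 := ⟨d - 2, by omega⟩
  rcases k with _ | k
  · obtain ⟨K, hK⟩ := IsOptProfile.levels_le_rpow_two
    exact ⟨K, fun T f ha hz hp hc => hK T f ⟨ha, hz, hp, hc⟩⟩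
  · obtain ⟨K, hK⟩ := IsOptProfile.levels_le_rpow k
    refine ⟨K, fun T f ha hz hp hc => ?_⟩
    have h := hK T f ⟨ha, hz, hp, hc⟩
    exact h

end Assembly

end Literature.MathematicalPhysics.StatisticalMechanics
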